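import Summits.NavierStokesRegularity.NavierStokesRegularity.Theses.AngularGalerkinLadder
import Summits.NavierStokesRegularity.NavierStokesRegularity.Theorems.NoOverheating.Negative.LadderLimitJoint
import Summits.NavierStokesRegularity.NavierStokesRegularity.Theorems.NoOverheating.Negative.FineRatioWindowsExcluded
import Summits.NavierStokesRegularity.NavierStokesRegularity.Theorems.NoOverheating.Negative.VanishingAngleSymmetryWindowsExcluded
import Literature.Analysis.FluidPDE.ChaeWolfRemovingDSSProofs
import Literature.Analysis.FluidPDE.ScalingUniformRecurrence
import Literature.Analysis.FluidPDE.NSLerayStrongLocalExistence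
import HarnessLib

/-!
# KJ-62b — Window sequences carrying an EXTRA plain self-similarity whose factor tends to one are
# excluded (route `AngularGalerkinLadder`, crux K2 `NoOverheating`; refuter lineage, Negative lane)

Stratum (S22), SEQUENCE-level, the scaling analogue of (S21): if the `n`-th profile of an admissible
window sequence is, besides its window structure `(cₙ, Rₙ)`, plainly `σₙ`-DSS
(`σₙ uₙ(σₙ² t, σₙ x) = uₙ(t, x)`) with `1 < σₙ → 1` — the profiles become self-similar "in finer
and finer discrete steps" — then for every `λ > 0` the integer powers `σₙ^{⌊log λ / log σₙ⌋} → λ`,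
each profile is DSS with that power (`IsDiscretelySelfSimilar.zpow`), and the identity passes to
the ladder limit thanks to the JOINT space–time uniform convergence on compact cylinders of
`AngularGalerkinLadderLadderLimitJoint.exists_ladderLimit_joint` (the time argument `λₙ² t`
moves): the cut-off limit is `λ`-DSS for EVERY `λ > 1`, in particular for one `λ` in Chae–Wolf's
fine range `(1, λ₁(C₀))`, and Chae–Wolf 2017 Thm. 1.3 (`chaeWolf2017_removing_dss_holds`, a
theorem of the tree) removes it — against the non-triviality of the limit.  (S5)
(`SelfSimilarWindowsExcluded`: exactly self-similar profiles, or ONE common extra factor in the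
fine range) is the constant case.

* `isDiscretelySelfSimilar_cutoff_of_tendstoUniformlyOn_of_factors_tendsto` — `lₙ`-DSS with
  `lₙ → λ > 0` passes to the cut-off limit (joint convergence); `…_of_factors_tendsto_one` — with
  `1 < σₙ → 1` the limit is `λ`-DSS for EVERY `λ > 0`;
* `no_windowSequence_extraFactors_tendsto` — sequence version of (S5): extra factors
  `σₙ → σ₀ ∈ [1, λ₁(C₀))` are excluded; `no_windowSequence_extraFactors_tendsto_one` — (S22), the
  case `σ₀ = 1`, free of `C₀`; `no_windowSequence_extraFactors_census` — census form.

READING FOR THE CIRCUIT: a K2 supply cannot degenerate towards CONTINUOUS self-similarity along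
the ladder by acquiring extra plain scaling symmetries of factor `→ 1`; genuinely discrete
self-similarity must persist at a fixed scale ratio.  No `kit`.
[cite: ChaeWolf2017RemovingDSS, Theorem 1.3 (arXiv:1610.09464 p. 3)]
[cite: KochNadirashviliSereginSverak2009, Lemma 6.1 (limits of rescaled solutions)] -/

namespace Summit.NavierStokesRegularity.AngularGalerkinLadderExtraFactorsTendingToOneExcluded

open Set Filter MeasureTheory Topology Function
open Literature.Analysis Literature.Analysis.FluidPDE
open Summit.NavierStokesRegularity.FluidComputer
open Summit.NavierStokesRegularity.FluidComputer.AngularLadder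
open Summit.NavierStokesRegularity.NavierStokesRegularity.Theses.AngularGalerkinLadder
open Summit.NavierStokesRegularity.AngularGalerkinLadderLadderLimitJoint
open Summit.NavierStokesRegularity.AngularGalerkinLadderFineRatioWindowsExcluded
open Summit.NavierStokesRegularity.AngularGalerkinLadderVanishingAngleSymmetryExcluded

/-! ## §1 Powers of factors tending to one reach every scale; DSS passes to the limit -/

/-- Along factors `1 < σₙ → 1`, the powers
`λₙ = exp(⌊log λ / log σₙ⌋ log σₙ) = σₙ^{⌊log λ/log σₙ⌋}` converge to `λ > 0`. [folklore] -/
theorem tendsto_exp_floor_mul_log {σ : ℕ → ℝ} (hσ1 : ∀ n, 1 < σ n) (hσ : Tendsto σ atTop (𝓝 1))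
    {lam : ℝ} (hlam : 0 < lam) :
    Tendsto (fun n => Real.exp ((⌊Real.log lam / Real.log (σ n)⌋ : ℝ) * Real.log (σ n))) atTop
      (𝓝 lam) := by
  have hlog : Tendsto (fun n => Real.log (σ n)) atTop (𝓝 0) := by
    have h := hσ.log one_ne_zero
    rwa [Real.log_one] at h
  have hlog0 : ∀ n, Real.log (σ n) ≠ 0 := fun n => (Real.log_pos (hσ1 n)).ne'
  have h1 := tendsto_floor_mul hlog hlog0 (Real.log lam)
  have h2 := (Real.continuous_exp.tendsto _).comp h1
  rwa [Real.exp_log hlam] at h2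

/-- The power `σ^{⌊log λ / log σ⌋}` written through `exp`. [folklore] -/
theorem exp_floor_mul_log_eq_zpow {σ : ℝ} (hσ : 0 < σ) (lam : ℝ) :
    Real.exp ((⌊Real.log lam / Real.log σ⌋ : ℝ) * Real.log σ) =
      σ ^ (⌊Real.log lam / Real.log σ⌋ : ℤ) := by
  rw [← Real.log_zpow, Real.exp_log (zpow_pos hσ _)]

/-- **Self-similarity with convergent factors passes to jointly-locally-uniform limits.**  If `uₙ`
is `lₙ`-DSS with `lₙ → λ > 0`, `uₙ → v` pointwise on `t < 0` and uniformly on the compact cylinders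
`[−(m+2), −1/(m+2)] × B̄(0, m+2)`, and `v` is jointly continuous on `(−∞, 0) × ℝ³`, then the
cut-off limit is `λ`-DSS (the time argument `lₙ² t` moves, whence the joint convergence).
[cite: KochNadirashviliSereginSverak2009, Lemma 6.1 (limits of rescaled solutions)] -/
theorem isDiscretelySelfSimilar_cutoff_of_tendstoUniformlyOn_of_factors_tendsto
    {u : ℕ → ℝ → EuclideanSpace ℝ (Fin 3) → EuclideanSpace ℝ (Fin 3)}
    {v : ℝ → EuclideanSpace ℝ (Fin 3) → EuclideanSpace ℝ (Fin 3)} {l : ℕ → ℝ} {lam : ℝ}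
    (hlss : ∀ n, IsDiscretelySelfSimilar (l n) (u n)) (hlt : Tendsto l atTop (𝓝 lam))
    (hlam : 0 < lam)
    (hptw : ∀ t < 0, ∀ x, Tendsto (fun n => u n t x) atTop (𝓝 (v t x)))
    (hunif : ∀ m : ℕ, TendstoUniformlyOn (fun j => uncurry (u j)) (uncurry v) atTop
      (Icc (-((m : ℝ) + 2)) (-(1 / ((m : ℝ) + 2))) ×ˢ
        Metric.closedBall (0 : EuclideanSpace ℝ (Fin 3)) ((m : ℝ) + 2)))
    (hvcont : ContinuousOn (uncurry v) (Iio 0 ×ˢ univ)) :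
    IsDiscretelySelfSimilar lam (fun t x => if t < 0 then v t x else 0) := by
  -- the identity `lₙ uₙ(lₙ² t, lₙ x) = uₙ(t, x)` passes to the limit at every `t < 0`
  unfold IsDiscretelySelfSimilar
  funext t x
  rw [nsRescale_apply]
  by_cases ht : t < 0
  · have hl2t : lam ^ 2 * t < 0 := mul_neg_of_pos_of_neg (by positivity) ht
    simp only [if_pos ht, if_pos hl2t]
    -- a compact cylinder around the limit point `z = (λ² t, λ x)`
    set a : ℝ := -(lam ^ 2 * t) with ha_def
    have ha : 0 < a := by rw [ha_def]; linarith
    obtain ⟨m, hm⟩ := exists_nat_gt (a + a⁻¹ + ‖lam • x‖)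
    have hainv : 0 < a⁻¹ := inv_pos.2 ha
    have hm2 : a + a⁻¹ + ‖lam • x‖ < (m : ℝ) + 2 := by linarith
    set S : Set (ℝ × EuclideanSpace ℝ (Fin 3)) :=
      Icc (-((m : ℝ) + 2)) (-(1 / ((m : ℝ) + 2))) ×ˢ
        Metric.closedBall (0 : EuclideanSpace ℝ (Fin 3)) ((m : ℝ) + 2) with hS
    have h_lo : -((m : ℝ) + 2) < lam ^ 2 * t := by
      have : a < (m : ℝ) + 2 := by linarith [norm_nonneg (lam • x)]
      rw [ha_def] at this; linarith
    have h_hi : lam ^ 2 * t < -(1 / ((m : ℝ) + 2)) := by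
      have hm0 : (0 : ℝ) < (m : ℝ) + 2 := by positivity
      have h1 : a⁻¹ < (m : ℝ) + 2 := by linarith [norm_nonneg (lam • x)]
      have h2 : 1 / ((m : ℝ) + 2) < a := by
        rw [one_div]
        calc ((m : ℝ) + 2)⁻¹ < a⁻¹⁻¹ := by
              exact inv_strictAnti₀ hainv h1
          _ = a := inv_inv a
      rw [ha_def] at h2; linarith
    have h_ball : lam • x ∈ Metric.ball (0 : EuclideanSpace ℝ (Fin 3)) ((m : ℝ) + 2) := by
      rw [Metric.mem_ball, dist_zero_right]
      linarith [ha.le, hainv.le]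
    have hSz : S ∈ 𝓝 ((lam ^ 2 * t, lam • x) : ℝ × EuclideanSpace ℝ (Fin 3)) := by
      refine mem_of_superset (prod_mem_nhds (isOpen_Ioo.mem_nhds ⟨h_lo, h_hi⟩)
        (Metric.isOpen_ball.mem_nhds h_ball)) ?_
      exact prod_mono Ioo_subset_Icc_self Metric.ball_subset_closedBall
    have hSsub : S ⊆ Iio 0 ×ˢ univ := by
      refine prod_mono (fun s hs => ?_) (subset_univ _)
      have hm0 : (0 : ℝ) < 1 / ((m : ℝ) + 2) := by positivity
      exact lt_of_le_of_lt hs.2 (by linarith)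
    -- the moving space–time points `zₙ = (λₙ² t, λₙ x) → z`, within `S`
    have hz : Tendsto (fun n => ((l n) ^ 2 * t, l n • x)) atTop
        (𝓝 ((lam ^ 2 * t, lam • x) : ℝ × EuclideanSpace ℝ (Fin 3))) :=
      ((hlt.pow 2).mul_const t).prodMk_nhds (hlt.smul tendsto_const_nhds)
    have hzS : Tendsto (fun n => ((l n) ^ 2 * t, l n • x)) atTop
        (𝓝[S] ((lam ^ 2 * t, lam • x) : ℝ × EuclideanSpace ℝ (Fin 3))) :=
      tendsto_nhdsWithin_iff.2 ⟨hz, hz.eventually_mem hSz⟩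
    have hcont : ContinuousWithinAt (uncurry v) S (lam ^ 2 * t, lam • x) :=
      (hvcont (lam ^ 2 * t, lam • x) (mk_mem_prod (mem_Iio.2 hl2t) (mem_univ _))).mono hSsub
    -- left side: `λₙ uₙ(λₙ² t, λₙ x) → λ v(λ² t, λ x)`
    have hL : Tendsto (fun n => l n • u n ((l n) ^ 2 * t) (l n • x)) atTop
        (𝓝 (lam • v (lam ^ 2 * t) (lam • x))) :=
      hlt.smul ((hunif m).tendsto_comp hcont hzS)
    -- right side: `uₙ(t, x) → v(t, x)`; the two sides agree for every `n`
    have hE : (fun n => l n • u n ((l n) ^ 2 * t) (l n • x)) = fun n => u n t x := by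
      funext n
      have := congrFun (congrFun (hlss n) t) x
      rwa [nsRescale_apply] at this
    rw [hE] at hL
    exact tendsto_nhds_unique hL (hptw t ht x)
  · have hl2t : ¬ lam ^ 2 * t < 0 := fun h =>
      ht (by nlinarith [sq_nonneg lam, pow_pos hlam 2])
    simp only [if_neg ht, if_neg hl2t, smul_zero]

/-- **Factors tending to one: the limit is self-similar at EVERY scale.**  If `uₙ` is `σₙ`-DSS
with `1 < σₙ → 1`, then (same convergence hypotheses) the cut-off limit is `λ`-DSS for every
`λ > 0`: apply the previous lemma to the integer powers `σₙ^{⌊log λ / log σₙ⌋} → λ`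
(`IsDiscretelySelfSimilar.zpow`, `tendsto_exp_floor_mul_log`). [folklore] -/
theorem isDiscretelySelfSimilar_cutoff_of_tendstoUniformlyOn_of_factors_tendsto_one
    {u : ℕ → ℝ → EuclideanSpace ℝ (Fin 3) → EuclideanSpace ℝ (Fin 3)}
    {v : ℝ → EuclideanSpace ℝ (Fin 3) → EuclideanSpace ℝ (Fin 3)} {σ : ℕ → ℝ}
    (hσ1 : ∀ n, 1 < σ n) (hσ : Tendsto σ atTop (𝓝 1))
    (hss : ∀ n, IsDiscretelySelfSimilar (σ n) (u n))
    (hptw : ∀ t < 0, ∀ x, Tendsto (fun n => u n t x) atTop (𝓝 (v t x)))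
    (hunif : ∀ m : ℕ, TendstoUniformlyOn (fun j => uncurry (u j)) (uncurry v) atTop
      (Icc (-((m : ℝ) + 2)) (-(1 / ((m : ℝ) + 2))) ×ˢ
        Metric.closedBall (0 : EuclideanSpace ℝ (Fin 3)) ((m : ℝ) + 2)))
    (hvcont : ContinuousOn (uncurry v) (Iio 0 ×ˢ univ)) {lam : ℝ} (hlam : 0 < lam) :
    IsDiscretelySelfSimilar lam (fun t x => if t < 0 then v t x else 0) := by
  refine isDiscretelySelfSimilar_cutoff_of_tendstoUniformlyOn_of_factors_tendsto
    (l := fun n => Real.exp ((⌊Real.log lam / Real.log (σ n)⌋ : ℝ) * Real.log (σ n)))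
    (fun n => ?_) (tendsto_exp_floor_mul_log hσ1 hσ hlam) hlam hptw hunif hvcont
  rw [exp_floor_mul_log_eq_zpow (zero_lt_one.trans (hσ1 n))]
  exact (hss n).zpow (zero_lt_one.trans (hσ1 n)).ne' _

/-! ## §2 (S22): no admissible window sequence carries extra plain DSS factors tending to one
## (or to a limit in Chae–Wolf's fine range) -/

/-- **Sequence version of (S5), including the degenerate limit `σ₀ = 1`.**  For every `C₀` there
is `c₁ = λ₁(C₀) > 1` such that no admissible window sequence (`1 < cmin`, `0 < δ`, `εₙ → 0`, ANY
rotations, ANY window) is in addition plainly `σₙ`-DSS with `1 < σₙ → σ₀`, `1 ≤ σ₀ < c₁`: the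
cut-off ladder limit (`exists_ladderLimit_joint`) is `λ`-DSS for `λ = σ₀` if `σ₀ > 1`
(`isDiscretelySelfSimilar_cutoff_of_tendstoUniformlyOn_of_factors_tendsto`) and for
`λ = (1 + c₁)/2` if `σ₀ = 1` (`…_of_factors_tendsto_one`); it is a classical Type-I (`C₀`) ancient
solution for one pressure on the whole past (`exists_classical_Iio`), so Chae–Wolf 2017 Thm. 1.3
(`chaeWolf2017_removing_dss_holds`) makes it vanish — against non-triviality.  (`C₀ ≤ 0` is
vacuous by the amplitude floor, `typeI_const_pos_of_window`.)
[cite: ChaeWolf2017RemovingDSS, Theorem 1.3 (arXiv:1610.09464 p. 3)] -/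
theorem no_windowSequence_extraFactors_tendsto (C₀ : ℝ) :
    ∃ c₁ : ℝ, 1 < c₁ ∧ ∀ {cmin cmax δ σ₀ : ℝ} {L : ℕ → ℕ} {ε c σ : ℕ → ℝ}
      {R : ℕ → (EuclideanSpace ℝ (Fin 3) ≃ₗᵢ[ℝ] EuclideanSpace ℝ (Fin 3))}
      {u : ℕ → ℝ → EuclideanSpace ℝ (Fin 3) → EuclideanSpace ℝ (Fin 3)}
      {p : ℕ → ℝ → EuclideanSpace ℝ (Fin 3) → ℝ}
      {d : ℕ → ℝ → EuclideanSpace ℝ (Fin 3) → EuclideanSpace ℝ (Fin 3)},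
      1 ≤ σ₀ → σ₀ < c₁ → 1 < cmin → 0 < δ → Tendsto ε atTop (𝓝 0) →
      (∀ n, IsWindowProfile (L n) C₀ cmin cmax δ (ε n) (c n) (R n) (u n) (p n) (d n)) →
      (∀ n, 1 < σ n) → Tendsto σ atTop (𝓝 σ₀) →
      (∀ n, IsDiscretelySelfSimilar (σ n) (u n)) → False := by
  by_cases hC₀ : 0 < C₀
  swap
  · exact ⟨2, one_lt_two, fun _ _ _ hδ _ hW _ _ _ => hC₀ (typeI_const_pos_of_window hδ (hW 0))⟩
  obtain ⟨c₁, hc₁, H⟩ := chaeWolf2017_removing_dss_holds C₀ hC₀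
  refine ⟨c₁, hc₁,
    fun {cmin cmax δ σ₀ L ε c σ R u p d} hσ₀ hσ₀c hcmin hδ hε hW hσ1 hσ hss => ?_⟩
  obtain ⟨φ, c', R', v, hφ, -, -, -, hptw, -, hvcont, -, hTAM, -, -, hTI, -, hnz, hunif⟩ :=
    exists_ladderLimit_joint hcmin hδ hε hW
  set w : ℝ → EuclideanSpace ℝ (Fin 3) → EuclideanSpace ℝ (Fin 3) :=
    fun t x => if t < 0 then v t x else 0 with hwdef
  -- the cutoff of the ladder limit is `λ`-DSS for one `λ` in the fine range `(1, c₁)`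
  obtain ⟨lam, hlam1, hlamc, hw⟩ : ∃ lam, 1 < lam ∧ lam < c₁ ∧ IsDiscretelySelfSimilar lam w := by
    rcases hσ₀.eq_or_lt with h | h
    · refine ⟨(1 + c₁) / 2, by linarith, by linarith, ?_⟩
      rw [← h] at hσ
      exact isDiscretelySelfSimilar_cutoff_of_tendstoUniformlyOn_of_factors_tendsto_one
        (u := fun n => u (φ n)) (σ := fun n => σ (φ n)) (fun n => hσ1 _)
        (hσ.comp hφ.tendsto_atTop) (fun n => hss (φ n)) hptw hunif hvcont (by linarith)
    · exact ⟨σ₀, h, hσ₀c,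
        isDiscretelySelfSimilar_cutoff_of_tendstoUniformlyOn_of_factors_tendsto
          (u := fun n => u (φ n)) (l := fun n => σ (φ n)) (fun n => hss (φ n))
          (hσ.comp hφ.tendsto_atTop) (by linarith) hptw hunif hvcont⟩
  -- one pressure on the whole past for the limit, transported to the cutoff
  obtain ⟨P, hP⟩ := exists_classical_Iio hTAM
  have hwv : ∀ t ∈ Iio (0 : ℝ), w t = v t := fun t ht => by
    funext x
    simp only [hwdef, if_pos (mem_Iio.1 ht)]
  have hPw : IsClassicalNSSolutionOn (Iio 0) 1 0 w P := hP.congr_velocity hwv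
  have hTIw : HasTypeIDecay C₀ w := fun t ht x => by
    simp only [hwdef, if_pos ht]
    exact hTI t ht x
  have hz : ∀ t < 0, ∀ x, w t x = 0 := H lam hlam1 hlamc w P hPw hw hTIw
  refine hnz fun t ht => Eventually.of_forall fun x => ?_
  have h3 := hz t ht x
  simp only [hwdef, if_pos ht] at h3
  simpa using h3

variable {C₀ cmin cmax δ : ℝ} {L : ℕ → ℕ} {ε c : ℕ → ℝ}
  {R : ℕ → (EuclideanSpace ℝ (Fin 3) ≃ₗᵢ[ℝ] EuclideanSpace ℝ (Fin 3))}
  {u : ℕ → ℝ → EuclideanSpace ℝ (Fin 3) → EuclideanSpace ℝ (Fin 3)}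
  {p : ℕ → ℝ → EuclideanSpace ℝ (Fin 3) → ℝ}
  {d : ℕ → ℝ → EuclideanSpace ℝ (Fin 3) → EuclideanSpace ℝ (Fin 3)}

/-- **(S22) No admissible window sequence is, in addition, plainly `σₙ`-DSS with `1 < σₙ → 1`**
— for ANY `C₀`, ANY rotations, ANY window (the case `σ₀ = 1` of
`no_windowSequence_extraFactors_tendsto`: the cut-off ladder limit would be `λ`-DSS for every
`λ > 0`). [cite: ChaeWolf2017RemovingDSS, Theorem 1.3 (arXiv:1610.09464 p. 3)] -/
theorem no_windowSequence_extraFactors_tendsto_one (hcmin : 1 < cmin) (hδ : 0 < δ)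
    (hε : Tendsto ε atTop (𝓝 0))
    (hW : ∀ n, IsWindowProfile (L n) C₀ cmin cmax δ (ε n) (c n) (R n) (u n) (p n) (d n))
    (σ : ℕ → ℝ) (hσ1 : ∀ n, 1 < σ n) (hσ : Tendsto σ atTop (𝓝 1))
    (hss : ∀ n, IsDiscretelySelfSimilar (σ n) (u n)) : False := by
  obtain ⟨c₁, hc₁, H⟩ := no_windowSequence_extraFactors_tendsto C₀
  exact H le_rfl hc₁ hcmin hδ hε hW hσ1 hσ hss

/-- **(S22) in census form**: the extra-self-similarity factors of an admissible window sequence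
cannot tend to one. -/
theorem no_windowSequence_extraFactors_census (hcmin : 1 < cmin) (hδ : 0 < δ)
    (hε : Tendsto ε atTop (𝓝 0))
    (hW : ∀ n, IsWindowProfile (L n) C₀ cmin cmax δ (ε n) (c n) (R n) (u n) (p n) (d n)) :
    ¬ (∃ σ : ℕ → ℝ, (∀ n, 1 < σ n) ∧ Tendsto σ atTop (𝓝 1) ∧
        ∀ n, IsDiscretelySelfSimilar (σ n) (u n)) :=
  fun ⟨σ, hσ1, hσ, hss⟩ => no_windowSequence_extraFactors_tendsto_one hcmin hδ hε hW σ hσ1 hσ hss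

end Summit.NavierStokesRegularity.AngularGalerkinLadderExtraFactorsTendingToOneExcluded
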